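import Literature.MathematicalPhysics.QuantumLattice.HeisenbergOrder
import HarnessLib

/-!
# Kennedy–Lieb–Shastry: long-range order in the ground state of the quantum XY model

Trunk T-QLATTICE (Literature/MathematicalPhysics/QuantumLattice); cite item `wi-03675` (route
HubbardSuperconductivity/ShibaRP, crux #3 template; model instance behind `GSCertificate`).
Companion to `HeisenbergOrder.lean` (same vocabulary: `Op`, `siteSpin`, `torusGraph`,
`Matrix.groundStateFunctional`, even-torus LRO).

The nearest-neighbour ferromagnetic quantum XY model of spin `S = n/2` on the torus `(ℤ/Lℤ)^d`,
`H_L = -Σ_{⟨x,y⟩} (S¹_x S¹_y + S²_x S²_y)` (the tree's `xxzHamiltonian` with `Δ = 0`, `J = -1`;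
for `S = 1/2` equivalently hard-core bosons at half filling), has ground states with off-diagonal
long-range order in EVERY dimension `d ≥ 2` and for EVERY spin `S ≥ 1/2` (Kennedy–Lieb–Shastry
1988, PRL 61, 2582, Thm.; the `S ≥ 1`, `d = 2` Heisenberg antiferromagnet analogue is
Neves–Perez 1986; the method is Dyson–Lieb–Simon's reflection positivity / infrared bound taken to
`T = 0` with the KLS sum rule). Also at low temperature for `d ≥ 3` (Gibbs states).

## Contents

* `xyTorus d L n`, the ground-state XY correlation `groundStateXYCorrTorus L n x y =
  Re Σ_{α=1,2} ω₀(S^α_x S^α_y)`, its thermal analogue `xyCorrTorus β L n x y`, and plain LRO along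
  even tori `HasEvenTorusLRO` (RP needs even side);
* named facts `kennedy_lieb_shastry_xy_ground` (all `d ≥ 2`, all `n ≥ 1`) and
  `kennedy_lieb_shastry_xy_thermal` (`d ≥ 3`, low temperature).

## Sources

* T. Kennedy, E. H. Lieb, B. S. Shastry, *The XY model has long-range order for all spins and all
  dimensions greater than one*, Phys. Rev. Lett. 61 (1988) 2582–2584, Theorem (`KLS1988PRL`).
* E. J. Neves, J. F. Perez, Phys. Lett. A 114 (1986) 331.
* F. J. Dyson, E. H. Lieb, B. Simon, J. Stat. Phys. 18 (1978) 335, Thms. 3.1–4.2.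
-/

noncomputable section

open Filter Topology Matrix
open Literature.MathematicalPhysics.QuantumLattice Literature.Probability.LatticeModels

namespace Literature.MathematicalPhysics.QuantumLattice

variable {d : ℕ}

/-- The ferromagnetic quantum XY Hamiltonian `H_L = -Σ_{⟨x,y⟩} (S¹_x S¹_y + S²_x S²_y)` of spin
`n/2` on the torus `(ℤ/Lℤ)^d` (`xxzHamiltonian` with `J = -1`, `Δ = 0`).
[Kennedy–Lieb–Shastry 1988, eq. (1)] [cite: KLS1988PRL, eq. (1)] -/
abbrev xyTorus (d L : ℕ) [NeZero L] (n : ℕ) : Op (TorusSite d L) (n + 1) :=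
  xxzHamiltonian n (torusGraph d L) (-1) 0

/-- The ground-state XY correlation `Re Σ_{α ∈ {1,2}} ω₀(S^α_x S^α_y)` in the tracial ground-state
functional of `xyTorus d L n` (junk `0` for `L = 0`). [Kennedy–Lieb–Shastry 1988, Thm.
(the order parameter `Σ_{x,y} ⟨S^x_x S^x_y + S^y_x S^y_y⟩`)] [cite: KLS1988PRL, Theorem] -/
def groundStateXYCorrTorus (L n : ℕ) (x y : TorusSite d L) : ℝ :=
  if hL : L = 0 then 0
  else
    haveI : NeZero L := ⟨hL⟩
    (∑ α : Fin 2, (xyTorus d L n).groundStateFunctional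
      (siteSpin n x (Fin.castLE (by norm_num) α) * siteSpin n y (Fin.castLE (by norm_num) α))).re

/-- The thermal XY correlation `Re Σ_{α ∈ {1,2}} ⟨S^α_x S^α_y⟩_{β,L}` in the Gibbs state of
`xyTorus d L n` (junk `0` for `L = 0`). [Kennedy–Lieb–Shastry 1988; Dyson–Lieb–Simon 1978, §1] [cite: DysonLiebSimon1978, §1] -/
def xyCorrTorus (β : ℝ) (L n : ℕ) (x y : TorusSite d L) : ℝ :=
  if hL : L = 0 then 0
  else
    haveI : NeZero L := ⟨hL⟩
    (∑ α : Fin 2, thermalCorr β (xyTorus d L n)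
      (siteSpin n x (Fin.castLE (by norm_num) α)) (siteSpin n y (Fin.castLE (by norm_num) α))).re

/-- Plain (unstaggered) long-range order along EVEN tori:
`0 < liminf_k (2k)^{-2d} Σ_{x,y ∈ (ℤ/2kℤ)^d} G (2k) x y` (reflection positivity requires even
side; implemented like `HasStaggeredEvenTorusLRO` with trivial sign).
[Dyson–Lieb–Simon 1978, §1; Kennedy–Lieb–Shastry 1988] [folklore] -/
def HasEvenTorusLRO (G : (L : ℕ) → TorusSite d L → TorusSite d L → ℝ) : Prop :=
  HasLongRangeOrder (fun k => halfOpenBox d (2 * k)) (fun k => torusPullback G (2 * k))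

/-- **Kennedy–Lieb–Shastry** (ground state): for every dimension `d ≥ 2` and every spin
`S = n/2 ≥ 1/2`, the ground states of the ferromagnetic quantum XY model on the even tori
`(ℤ/2kℤ)^d` (tracial ground-state functional) have long-range order:
`liminf_k (2k)^{-2d} Σ_{x,y} ⟨S¹_x S¹_y + S²_x S²_y⟩_{GS} > 0`. Method: RP ⇒ Gaussian domination of
the Duhamel two-point function `≤ 1/(2E(k))`, the `T = 0` Falk–Bruch step, and the sum rule
leaving a positive `k = 0` mass. [Kennedy–Lieb–Shastry 1988, Theorem; Neves–Perez 1986;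
Dyson–Lieb–Simon 1978, Thms. 3.1–4.2] [cite: KLS1988PRL, Theorem] -/
def kennedy_lieb_shastry_xy_ground : Prop :=
  ∀ (d : ℕ), 2 ≤ d → ∀ (n : ℕ), 1 ≤ n →
    HasEvenTorusLRO (fun L x y => groundStateXYCorrTorus (d := d) L n x y)

/-- **Kennedy–Lieb–Shastry / Dyson–Lieb–Simon** (positive temperature): for `d ≥ 3` and every spin
`S = n/2 ≥ 1/2` there is `β₀` such that for `β ≥ β₀` the Gibbs states of the ferromagnetic quantum
XY model on even tori have long-range order. [Kennedy–Lieb–Shastry 1988 (remark); Dyson–Lieb–Simon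
1978, Thm. 4.2 (XY case)] [cite: DysonLiebSimon1978, Thm. 4.2] -/
def kennedy_lieb_shastry_xy_thermal : Prop :=
  ∀ (d : ℕ), 3 ≤ d → ∀ (n : ℕ), 1 ≤ n → ∃ β₀ : ℝ, 0 < β₀ ∧ ∀ β : ℝ, β₀ ≤ β →
    HasEvenTorusLRO (fun L x y => xyCorrTorus (d := d) β L n x y)

/-! ### API -/

/-- Junk side. [folklore] -/
@[simp] theorem groundStateXYCorrTorus_zero_side (n : ℕ) (x y : TorusSite d 0) :
    groundStateXYCorrTorus 0 n x y = 0 := by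
  simp [groundStateXYCorrTorus]

/-- Unfolding on a genuine torus. [Kennedy–Lieb–Shastry 1988] [folklore] -/
theorem groundStateXYCorrTorus_of_neZero (L : ℕ) [NeZero L] (n : ℕ) (x y : TorusSite d L) :
    groundStateXYCorrTorus L n x y =
      (∑ α : Fin 2, (xyTorus d L n).groundStateFunctional
        (siteSpin n x (Fin.castLE (by norm_num) α) *
          siteSpin n y (Fin.castLE (by norm_num) α))).re := by
  simp [groundStateXYCorrTorus, NeZero.ne L]

/-- `HasEvenTorusLRO` unfolds to Mathlib's `liminf` form over even sides through
`HasLongRangeOrder`. [Dyson–Lieb–Simon 1978, §1] [folklore] -/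
theorem hasEvenTorusLRO_iff (G : (L : ℕ) → TorusSite d L → TorusSite d L → ℝ) :
    HasEvenTorusLRO G ↔
      0 < liminf (fun k : ℕ => (∑ x ∈ halfOpenBox d (2 * k), ∑ y ∈ halfOpenBox d (2 * k),
        torusPullback G (2 * k) x y) / ((halfOpenBox d (2 * k)).card : ℝ) ^ 2) atTop :=
  Iff.rfl

end Literature.MathematicalPhysics.QuantumLattice
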